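import Summits.CriticalPhenomena.PercolationContinuityZ3.Theorems.PercAnnulusCrossingIICChemicalExponentDeterministic
import HarnessLib

/-!
# The volume exponents of Kesten's IIC are deterministic, and dominate the chemical exponents (lane RSW3, p1 gen 14)

builds on p205010 (kernel theorem, internal audit signed; external expert review pending) — used through `θ(p_c) = 0`
(`CSH.percolationContinuity_allDimensions`) and gen 14's a.s. volume envelope in the `criticalProbI` statements; the `ℤ²` statements are unconditional.

Seat `prim-rsw3-p1` (gen 14); memo `run/shared/lean/prim/rsw3/P1-QM.md` §27.  Helper file for the crux `stmt-CriticalPhenomena-4575`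
chain; no definitions, no sorries.

With `V_n = #{z ∈ Λ(n) : 0 ↔ z}` the volume of the IIC in `Λ(n)` and `D_n` its chemical distance to `Λ(n)ᶜ`:

* `measurable_of_measurable_natCast` — bookkeeping; **`iicMeasure_volume_far_sandwich`** — for every `K`, `W^K_n = #{z ∈ Λ(n) : z percolates in
  ω ∖ E⁺(Λ(K))}` is measurable, determined off `Λ(K)`, and `W^K_n ≤ V_n ≤ W^K_n + |bush_K(ω)|` for all `n`, `ν`-a.s. (gen 14 `finite_bush`);
* **`iicMeasure_exists_ae_volume_comp_rates_eq_const`** (`θ(p) = 0`, (A2)□, `2 ≤ s`) — for every admissible `φ` (nonnegative, monotone,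
  `φ(a+B) ≤ φ(a) + B'(B)`) and every `σ_n → ∞`: `limsup_n φ(V_n)/σ_n`, `liminf_n φ(V_n)/σ_n` are `ν`-a.s. constant (gen 14's engine);
* **`iicMeasure_exists_ae_volume_exponents_eq_const`** — **THE VOLUME EXPONENTS `β⁺ = limsup_n log V_n/log n`, `β⁻ = liminf_n log V_n/log n` OF
  KESTEN'S IIC ARE `ν`-A.S. CONSTANT** (normalisation `log(n+2)`);
* **`iicMeasure_volume_exponents_criticalProbI`** — at `p_c(ℤ^d)`, `d ≥ 2`, (A2)□ at aspect `(s,L)`, `2 ≤ s ≤ L`: deterministic constants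
  `1 ≤ α⁻ ≤ β⁻ ≤ β⁺ ≤ d` and `α⁻ ≤ α⁺ ≤ β⁺` with `liminf/limsup log D_n/log(n+2) = α∓` and `liminf/limsup log V_n/log(n+2) = β∓` `ν`-a.s. — **the
  chemical exponents are dominated by the volume exponents, all deterministic, in `[1, d]`**; **`iicMeasure_volume_exponents_Z2`** — the same for
  Kesten's planar IIC, unconditionally, in `[1, 2]` (quantitative bounds on `β⁺` — (T1) ⇒ `β⁺ ≤ d - c`, fatness ⇒ `β⁺ ≥ (d+1)/2`, planar
  `3/2 ≤ β⁺ ≤ 2 - 2^{-158}` — are in `…IICVolumeExponentBounds`).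

References: H. Kesten, PTRF 73 (1986), Thm. (8); G. Kozma, A. Nachmias, Invent. Math. 178 (2009); H.-O. Georgii (2011), Prop. 7.9.
-/

noncomputable section

namespace Summit.CriticalPhenomena.PercolationContinuityZ3.Theorems.Crossing

open MeasureTheory Filter Topology Literature.Probability.Percolation Literature.Probability.LatticeModels
open Literature.Probability.Percolation.DCT16 Literature.Probability.Percolation.DKT20
open Summit.CriticalPhenomena.PercolationContinuityZ3.Theorems.SurfaceTension
open scoped Literature.Probability.Percolation ENNReal symmDiff

variable {d : ℕ}

/-! ## The far sandwich for the volume -/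

/-- An `ℕ`-valued map whose real cast is measurable is measurable. [folklore] -/
theorem measurable_of_measurable_natCast {Ω : Type*} [MeasurableSpace Ω] {g : Ω → ℕ} (h : Measurable fun ω => (g ω : ℝ)) :
    Measurable g := by
  refine measurable_to_countable' fun k => ?_
  have : g ⁻¹' {k} = (fun ω => (g ω : ℝ)) ⁻¹' {(k : ℝ)} := by
    ext ω; simp only [Set.mem_preimage, Set.mem_singleton_iff, Nat.cast_inj]
  rw [this]
  exact h (measurableSet_singleton _)

open Classical in
/-- **The far sandwich for the volume** (`θ(p) = 0`, (A2)□ with `1 ≤ s`, `0 < p`, `d ≥ 1`; `ν` any IIC measure): for every `K`, the far volume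
`W^K_n(ω) = #{z ∈ Λ(n) : z percolates in ω ∖ E⁺(Λ(K))}` is measurable, determined off `Λ(K)`, and `ν`-a.s. `W^K_n ≤ V_n ≤ W^K_n + B(ω)` for ALL `n`
with `B = |bush_K(ω)| < ∞` (gen 14 `finite_bush`; far-percolating sites are joined to `0` a.s.). [cite: Kesten1986, Thm. (8)] -/
theorem iicMeasure_volume_far_sandwich (hd : 1 ≤ d) (p : unitInterval) (hp : 0 < (p : ℝ))
    (hθ : theta (zdGraph d) 0 p = 0) {s L : ℕ} (hs : 1 ≤ s) {ϰ : ℝ} (hϰ : 0 < ϰ) (hA2 : SetToSetQuasiMultAspectAt d p s L ϰ)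
    {ν : Measure (BondConfig (Site d))} [IsProbabilityMeasure ν]
    (hν : ∀ (F : Finset (Sym2 (Site d))) (E : Set (BondConfig (Site d))), MeasurableSet E → DeterminedBy E ↑F →
      Tendsto (fun n : ℕ => (bondPercolation (zdGraph d) p).real (E ∩ siteToBoundary d n) / oneArmProb d p n)
        atTop (𝓝 (ν.real E))) (K : ℕ) :
    ∃ W : ℕ → BondConfig (Site d) → ℕ, (∀ n, Measurable (W n)) ∧
      (∀ (n : ℕ) (ω ω' : BondConfig (Site d)), ω ∩ {e : Sym2 (Site d) | e ∉ (↑((box d K).sym2) : Set (Sym2 (Site d)))} =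
        ω' ∩ {e : Sym2 (Site d) | e ∉ (↑((box d K).sym2) : Set (Sym2 (Site d)))} → W n ω = W n ω') ∧
      ∀ᵐ ω ∂ν, ∃ B : ℕ, ∀ n : ℕ, W n ω ≤ ((box d n).filter fun z => ω ∈ (openConn (0 : Site d) z : Set (BondConfig (Site d)))).card ∧
        ((box d n).filter fun z => ω ∈ (openConn (0 : Site d) z : Set (BondConfig (Site d)))).card ≤ W n ω + B := by
  classical
  have hae := iicMeasure_ae_openConn_of_percolatesAt_sdiff hd p hp hθ hs hϰ hA2 hν
  have hlat := iicMeasure_ae_subset_edgeSet p hν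
  set T : Set (Sym2 (Site d)) := {e : Sym2 (Site d) | ∃ w ∈ box d K, w ∈ e} with hTdef
  set W : ℕ → BondConfig (Site d) → ℕ := fun n ω =>
    ((box d n).filter fun z => ω \ T ∈ (percolatesAt z : Set (BondConfig (Site d)))).card with hW
  refine ⟨W, fun n => measurable_of_measurable_natCast (measurable_card_filter_box n fun z =>
    measurable_sdiff_touching T (measurableSet_percolatesAt_holds z)), fun n ω ω' h => ?_, ?_⟩
  · have hT' : ω \ T = ω' \ T := sdiff_touching_eq_of_inter_eq h
    simp only [hW, hT']
  · filter_upwards [hae, hlat] with ω hω hωlat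
    have hfin := finite_bush K hωlat
    refine ⟨hfin.toFinset.card, fun n => ⟨?_, ?_⟩⟩
    · refine Finset.card_le_card fun z hz => ?_
      rw [Finset.mem_filter] at hz ⊢
      exact ⟨hz.1, hω T z hz.2⟩
    · have hsplit := Finset.card_filter_add_card_filter_not
        (s := (box d n).filter fun z => ω ∈ (openConn (0 : Site d) z : Set (BondConfig (Site d))))
        (fun z => ω \ T ∈ (percolatesAt z : Set (BondConfig (Site d))))
      have h1 : (((box d n).filter fun z => ω ∈ (openConn (0 : Site d) z : Set (BondConfig (Site d)))).filter
          fun z => ω \ T ∈ (percolatesAt z : Set (BondConfig (Site d)))).card ≤ W n ω := by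
        refine Finset.card_le_card fun z hz => ?_
        simp only [Finset.mem_filter] at hz ⊢
        exact ⟨hz.1.1, hz.2⟩
      have h2 : (((box d n).filter fun z => ω ∈ (openConn (0 : Site d) z : Set (BondConfig (Site d)))).filter
          fun z => ¬ ω \ T ∈ (percolatesAt z : Set (BondConfig (Site d)))).card ≤ hfin.toFinset.card := by
        refine Finset.card_le_card fun z hz => ?_
        simp only [Finset.mem_filter] at hz
        exact hfin.mem_toFinset.2 ⟨hz.1.2, hz.2⟩
      rw [← hsplit]; exact Nat.add_le_add h1 h2

open Classical in
/-- **Deterministic growth rates for every admissible function of the volume** (`θ(p) = 0`, (A2)□, `2 ≤ s`): for `φ : ℕ → ℝ` nonnegative,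
monotone, with `φ(a + B) ≤ φ(a) + B'(B)`, and every normalisation `σ_n → ∞`, `limsup_n φ(V_n)/σ_n` and `liminf_n φ(V_n)/σ_n` are `ν`-a.s. constant.
[cite: Kesten1986, Thm. (8)] [cite: Georgii2011, Prop. 7.9] -/
theorem iicMeasure_exists_ae_volume_comp_rates_eq_const (hd : 1 ≤ d) (p : unitInterval) (hp : 0 < (p : ℝ))
    (hθ : theta (zdGraph d) 0 p = 0) {s L : ℕ} (hs : 2 ≤ s) {ϰ : ℝ} (hϰ : 0 < ϰ) (hA2 : SetToSetQuasiMultAspectAt d p s L ϰ)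
    {ν : Measure (BondConfig (Site d))} [IsProbabilityMeasure ν]
    (hν : ∀ (F : Finset (Sym2 (Site d))) (E : Set (BondConfig (Site d))), MeasurableSet E → DeterminedBy E ↑F →
      Tendsto (fun n : ℕ => (bondPercolation (zdGraph d) p).real (E ∩ siteToBoundary d n) / oneArmProb d p n)
        atTop (𝓝 (ν.real E)))
    (φ : ℕ → ℝ) (hφ0 : ∀ a, 0 ≤ φ a) (hφm : Monotone φ) (hφB : ∀ B : ℕ, ∃ B' : ℝ, ∀ a : ℕ, φ (a + B) ≤ φ a + B')
    (σ : ℕ → ℝ) (hσ : ∀ n, 0 < σ n) (hσlim : Tendsto σ atTop atTop) :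
    (∃ c : ℝ≥0∞, ∀ᵐ ω ∂ν, limsup (fun n => ENNReal.ofReal
        (φ ((box d n).filter fun z => ω ∈ (openConn (0 : Site d) z : Set (BondConfig (Site d)))).card / σ n)) atTop = c) ∧
    (∃ c : ℝ≥0∞, ∀ᵐ ω ∂ν, liminf (fun n => ENNReal.ofReal
        (φ ((box d n).filter fun z => ω ∈ (openConn (0 : Site d) z : Set (BondConfig (Site d)))).card / σ n)) atTop = c) := by
  classical
  have hT := iicMeasure_isTailTrivial_of_setToSetQuasiMultAspectAt hd p hp hθ hs hϰ hA2 hν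
  refine exists_ae_eq_const_rates_of_far_sandwich hT
    (fun n ω => φ ((box d n).filter fun z => ω ∈ (openConn (0 : Site d) z : Set (BondConfig (Site d)))).card)
    (fun n => (measurable_from_nat (f := φ)).comp (measurable_of_measurable_natCast
      (measurable_card_filter_box n fun z => measurableSet_openConn_holds (0 : Site d) z)))
    (fun n ω => hφ0 _) (fun K => ?_) σ hσ hσlim
  obtain ⟨W, hWm, hWfar, hWsand⟩ := iicMeasure_volume_far_sandwich hd p hp hθ (by omega) hϰ hA2 hν K
  refine ⟨fun n ω => φ (W n ω), fun n => (measurable_from_nat (f := φ)).comp (hWm n), fun n ω => hφ0 _,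
    fun n ω ω' h => by simp only [hWfar n ω ω' h], ?_⟩
  filter_upwards [hWsand] with ω hω
  obtain ⟨B, hB⟩ := hω
  obtain ⟨B', hB'⟩ := hφB B
  have hB'0 : 0 ≤ B' := by
    have h1 := hB' 0
    have h2 : φ 0 ≤ φ (0 + B) := hφm (Nat.zero_le _)
    linarith
  exact ⟨B', Filter.Eventually.of_forall fun n =>
    ⟨(hφm (hB n).2).trans (hB' _), (hφm (hB n).1).trans (le_add_of_nonneg_right hB'0)⟩⟩

/-! ## The volume exponents -/

open Classical in
/-- **THE VOLUME EXPONENTS OF KESTEN'S IIC ARE DETERMINISTIC** (`θ(p) = 0`, (A2)□ at aspect `(s,L)`, `2 ≤ s`, `0 < p`, `d ≥ 1`): there are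
constants `β⁺, β⁻ ∈ [0,∞]` with `limsup_n log V_n / log(n+2) = β⁺` and `liminf_n log V_n / log(n+2) = β⁻` `ν`-a.s.
[cite: Kesten1986, Thm. (8)] [cite: Georgii2011, Prop. 7.9] -/
theorem iicMeasure_exists_ae_volume_exponents_eq_const (hd : 1 ≤ d) (p : unitInterval) (hp : 0 < (p : ℝ))
    (hθ : theta (zdGraph d) 0 p = 0) {s L : ℕ} (hs : 2 ≤ s) {ϰ : ℝ} (hϰ : 0 < ϰ) (hA2 : SetToSetQuasiMultAspectAt d p s L ϰ)
    {ν : Measure (BondConfig (Site d))} [IsProbabilityMeasure ν]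
    (hν : ∀ (F : Finset (Sym2 (Site d))) (E : Set (BondConfig (Site d))), MeasurableSet E → DeterminedBy E ↑F →
      Tendsto (fun n : ℕ => (bondPercolation (zdGraph d) p).real (E ∩ siteToBoundary d n) / oneArmProb d p n)
        atTop (𝓝 (ν.real E))) :
    (∃ c : ℝ≥0∞, ∀ᵐ ω ∂ν, limsup (fun n => ENNReal.ofReal
        (Real.log ((((box d n).filter fun z => ω ∈ (openConn (0 : Site d) z : Set (BondConfig (Site d)))).card : ℕ) : ℝ) /
          Real.log ((n : ℝ) + 2))) atTop = c) ∧
    (∃ c : ℝ≥0∞, ∀ᵐ ω ∂ν, liminf (fun n => ENNReal.ofReal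
        (Real.log ((((box d n).filter fun z => ω ∈ (openConn (0 : Site d) z : Set (BondConfig (Site d)))).card : ℕ) : ℝ) /
          Real.log ((n : ℝ) + 2))) atTop = c) :=
  iicMeasure_exists_ae_volume_comp_rates_eq_const hd p hp hθ hs hϰ hA2 hν (fun a => Real.log (a : ℝ)) Real.log_natCast_nonneg
    monotone_log_natCast (fun B => ⟨(B : ℝ), fun a => by simp only [Nat.cast_add]; exact log_natCast_add_le a B⟩)
    (fun n => Real.log ((n : ℝ) + 2)) (fun n => Real.log_pos (by linarith [(Nat.cast_nonneg n : (0 : ℝ) ≤ n)]))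
    (Real.tendsto_log_atTop.comp (tendsto_atTop_add_const_right _ _ tendsto_natCast_atTop_atTop))

open Classical in
/-- **THE CHEMICAL AND VOLUME EXPONENTS OF THE IIC AT `p_c(ℤ^d)`: DETERMINISTIC, `1 ≤ α⁻ ≤ β⁻ ≤ β⁺ ≤ d`, `α⁻ ≤ α⁺ ≤ β⁺`** (`d ≥ 2`, (A2)□ at
aspect `(s,L)`, `2 ≤ s ≤ L`; `ν` any IIC measure at `p_c`): `ν`-a.s. `liminf/limsup_n log D_n/log(n+2) = α⁻/α⁺` and
`liminf/limsup_n log V_n/log(n+2) = β⁻/β⁺` (`n + 1 ≤ D_n ≤ V_n ≤ n^δ n^d π_{p_c}(n)`).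
[cite: Kesten1986, Thm. (3), (8)] [cite: BasuSapozhnikov2017ECP, Thm. 1.1] [cite: Georgii2011, Prop. 7.9] -/
theorem iicMeasure_volume_exponents_criticalProbI (hd : 2 ≤ d) {s L : ℕ} (hs : 2 ≤ s) (hsL : s ≤ L) {ϰ : ℝ} (hϰ : 0 < ϰ)
    (hA2 : SetToSetQuasiMultAspectAt d (criticalProbI d) s L ϰ)
    {ν : Measure (BondConfig (Site d))} [IsProbabilityMeasure ν]
    (hν : ∀ (F : Finset (Sym2 (Site d))) (E : Set (BondConfig (Site d))), MeasurableSet E → DeterminedBy E ↑F →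
      Tendsto (fun n : ℕ => (bondPercolation (zdGraph d) (criticalProbI d)).real (E ∩ siteToBoundary d n) /
        oneArmProb d (criticalProbI d) n) atTop (𝓝 (ν.real E))) :
    ∃ αl αu βl βu : ℝ≥0∞, 1 ≤ αl ∧ αl ≤ αu ∧ αl ≤ βl ∧ αu ≤ βu ∧ βl ≤ βu ∧ βu ≤ d ∧ ∀ᵐ ω ∂ν,
      liminf (fun n => ENNReal.ofReal
        (Real.log (((⨅ v : {v : Site d // v ∉ box d n}, (openGraph ω).edist (0 : Site d) v.1).toNat : ℕ) : ℝ) /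
          Real.log ((n : ℝ) + 2))) atTop = αl ∧
      limsup (fun n => ENNReal.ofReal
        (Real.log (((⨅ v : {v : Site d // v ∉ box d n}, (openGraph ω).edist (0 : Site d) v.1).toNat : ℕ) : ℝ) /
          Real.log ((n : ℝ) + 2))) atTop = αu ∧
      liminf (fun n => ENNReal.ofReal
        (Real.log ((((box d n).filter fun z => ω ∈ (openConn (0 : Site d) z : Set (BondConfig (Site d)))).card : ℕ) : ℝ) /
          Real.log ((n : ℝ) + 2))) atTop = βl ∧
      limsup (fun n => ENNReal.ofReal
        (Real.log ((((box d n).filter fun z => ω ∈ (openConn (0 : Site d) z : Set (BondConfig (Site d)))).card : ℕ) : ℝ) /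
          Real.log ((n : ℝ) + 2))) atTop = βu := by
  classical
  have hd1 : 1 ≤ d := by omega
  have hpc : 0 < ((criticalProbI d : unitInterval) : ℝ) := by rw [coe_criticalProbI]; exact criticalProb_zd_pos d hd1
  have hθ := CSH.percolationContinuity_allDimensions d hd
  obtain ⟨αl, αu, hαl1, hαlu, -, hα⟩ := iicMeasure_chemical_exponents_criticalProbI hd hs hsL hϰ hA2 hν
  obtain ⟨⟨βu, hβu⟩, βl, hβl⟩ := iicMeasure_exists_ae_volume_exponents_eq_const hd1 (criticalProbI d) hpc hθ hs hϰ hA2 hν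
  have h2 : ∀ n : ℕ, 0 < Real.log ((n : ℝ) + 2) := fun n => Real.log_pos (by linarith [(Nat.cast_nonneg n : (0 : ℝ) ≤ n)])
  -- pointwise comparison of the two sequences on the a.s. set where `D_n ≤ V_n`
  have hcmp : ∀ᵐ ω ∂ν, ∀ n : ℕ, ENNReal.ofReal
      (Real.log (((⨅ v : {v : Site d // v ∉ box d n}, (openGraph ω).edist (0 : Site d) v.1).toNat : ℕ) : ℝ) /
        Real.log ((n : ℝ) + 2)) ≤ ENNReal.ofReal
      (Real.log ((((box d n).filter fun z => ω ∈ (openConn (0 : Site d) z : Set (BondConfig (Site d)))).card : ℕ) : ℝ) /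
        Real.log ((n : ℝ) + 2)) := by
    filter_upwards [iicMeasure_ae_chemical_le_volume hd1 (criticalProbI d) hpc hν] with ω hω n
    exact ENNReal.ofReal_le_ofReal (div_le_div_of_nonneg_right (monotone_log_natCast (hω n).2) (h2 n).le)
  -- the upper volume exponent is at most `d`
  have hβud : βu ≤ d := by
    refine ENNReal.le_of_forall_pos_le_add fun δ hδ _ => ?_
    have hδ' : (0 : ℝ) < δ := by exact_mod_cast hδ
    obtain ⟨ω, hωc, hω⟩ := (hβu.and (iicMeasure_ae_eventually_volume_le_rpow hd hs hsL hϰ hA2 hν hδ')).exists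
    rw [← hωc]
    refine limsup_le_of_le (by isBoundedDefault) ?_
    filter_upwards [hω, Filter.eventually_ge_atTop 1] with n hn hn1
    have hn0 : (0 : ℝ) < n := by exact_mod_cast hn1
    have hπ1 : oneArmProb d (criticalProbI d) n ≤ 1 := measureReal_le_one
    have hpow : (n : ℝ) ^ (δ : ℝ) * ((n : ℝ) ^ d * oneArmProb d (criticalProbI d) n) ≤ (n : ℝ) ^ (δ : ℝ) * (n : ℝ) ^ d := by
      have h0 : 0 ≤ (n : ℝ) ^ (δ : ℝ) * (n : ℝ) ^ d := by positivity
      calc (n : ℝ) ^ (δ : ℝ) * ((n : ℝ) ^ d * oneArmProb d (criticalProbI d) n)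
          = ((n : ℝ) ^ (δ : ℝ) * (n : ℝ) ^ d) * oneArmProb d (criticalProbI d) n := by ring
        _ ≤ ((n : ℝ) ^ (δ : ℝ) * (n : ℝ) ^ d) * 1 := mul_le_mul_of_nonneg_left hπ1 h0
        _ = (n : ℝ) ^ (δ : ℝ) * (n : ℝ) ^ d := mul_one _
    set V : ℕ := ((box d n).filter fun z => ω ∈ (openConn (0 : Site d) z : Set (BondConfig (Site d)))).card with hV
    have hbound : Real.log ((V : ℕ) : ℝ) ≤ ((d : ℝ) + δ) * Real.log ((n : ℝ) + 2) := by
      rcases Nat.eq_zero_or_pos V with h0 | hpos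
      · rw [h0, Nat.cast_zero, Real.log_zero]; exact mul_nonneg (by positivity) (h2 n).le
      · calc Real.log ((V : ℕ) : ℝ) ≤ Real.log ((n : ℝ) ^ (δ : ℝ) * (n : ℝ) ^ d) :=
              Real.log_le_log (by exact_mod_cast hpos) (hn.trans hpow)
          _ = (δ : ℝ) * Real.log n + (d : ℝ) * Real.log n := by
              rw [Real.log_mul (by positivity) (by positivity), Real.log_rpow hn0, Real.log_pow]
          _ = ((d : ℝ) + δ) * Real.log n := by ring
          _ ≤ ((d : ℝ) + δ) * Real.log ((n : ℝ) + 2) :=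
              mul_le_mul_of_nonneg_left (Real.log_le_log hn0 (by linarith)) (by positivity)
    calc ENNReal.ofReal (Real.log ((V : ℕ) : ℝ) / Real.log ((n : ℝ) + 2))
        ≤ ENNReal.ofReal ((d : ℝ) + δ) := ENNReal.ofReal_le_ofReal (by rw [div_le_iff₀ (h2 n)]; exact hbound)
      _ = (d : ℝ≥0∞) + δ := by
          rw [ENNReal.ofReal_add (by positivity) (by positivity), ENNReal.ofReal_natCast, ENNReal.ofReal_coe_nnreal]
  obtain ⟨ω, hωα, hωβu, hωβl, hωcmp⟩ := (hα.and (hβu.and (hβl.and hcmp))).exists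
  refine ⟨αl, αu, βl, βu, hαl1, hαlu, ?_, ?_, ?_, hβud, ?_⟩
  · rw [← hωα.1, ← hωβl]
    exact liminf_le_liminf (Filter.Eventually.of_forall hωcmp)
  · rw [← hωα.2, ← hωβu]
    exact limsup_le_limsup (Filter.Eventually.of_forall hωcmp)
  · rw [← hωβl, ← hωβu]
    exact liminf_le_limsup
  · filter_upwards [hα, hβu, hβl] with ω' h1 h2 h3
    exact ⟨h1.1, h1.2, h3, h2⟩

open Classical in
/-- **Kesten's planar IIC, unconditionally: deterministic chemical and volume exponents `1 ≤ α⁻ ≤ β⁻ ≤ β⁺ ≤ 2`, `α⁻ ≤ α⁺ ≤ β⁺`** ((A2)□ at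
aspect `(9,77)` by RSW). [cite: Kesten1986, Thm. (3), (8)] [cite: Georgii2011, Prop. 7.9] -/
theorem iicMeasure_volume_exponents_Z2 {ν : Measure (BondConfig (Site 2))} [IsProbabilityMeasure ν]
    (hν : ∀ (F : Finset (Sym2 (Site 2))) (E : Set (BondConfig (Site 2))), MeasurableSet E → DeterminedBy E ↑F →
      Tendsto (fun n : ℕ => (bondPercolation (zdGraph 2) (criticalProbI 2)).real (E ∩ siteToBoundary 2 n) /
        oneArmProb 2 (criticalProbI 2) n) atTop (𝓝 (ν.real E))) :
    ∃ αl αu βl βu : ℝ≥0∞, 1 ≤ αl ∧ αl ≤ αu ∧ αl ≤ βl ∧ αu ≤ βu ∧ βl ≤ βu ∧ βu ≤ 2 ∧ ∀ᵐ ω ∂ν,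
      liminf (fun n => ENNReal.ofReal
        (Real.log (((⨅ v : {v : Site 2 // v ∉ box 2 n}, (openGraph ω).edist (0 : Site 2) v.1).toNat : ℕ) : ℝ) /
          Real.log ((n : ℝ) + 2))) atTop = αl ∧
      limsup (fun n => ENNReal.ofReal
        (Real.log (((⨅ v : {v : Site 2 // v ∉ box 2 n}, (openGraph ω).edist (0 : Site 2) v.1).toNat : ℕ) : ℝ) /
          Real.log ((n : ℝ) + 2))) atTop = αu ∧
      liminf (fun n => ENNReal.ofReal
        (Real.log ((((box 2 n).filter fun z => ω ∈ (openConn (0 : Site 2) z : Set (BondConfig (Site 2)))).card : ℕ) : ℝ) /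
          Real.log ((n : ℝ) + 2))) atTop = βl ∧
      limsup (fun n => ENNReal.ofReal
        (Real.log ((((box 2 n).filter fun z => ω ∈ (openConn (0 : Site 2) z : Set (BondConfig (Site 2)))).card : ℕ) : ℝ) /
          Real.log ((n : ℝ) + 2))) atTop = βu := by
  obtain ⟨ϰ, hϰ, hA2⟩ := exists_setToSetQuasiMultAspectAt_two_of_criticalProbI_le
  have h := iicMeasure_volume_exponents_criticalProbI (d := 2) le_rfl (by norm_num) (by norm_num) hϰ (hA2 _ le_rfl) hν
  simpa using h

end Summit.CriticalPhenomena.PercolationContinuityZ3.Theorems.Crossing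

end
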